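import Summits.ValiantsHypothesis.ValiantsHypothesis.Theorems.BarrierLeverAnchoredDoorHitsLowerPairsBase
import Summits.ValiantsHypothesis.ValiantsHypothesis.Theorems.BarrierLeverAnchoredDoorHitsLowerPairsSwap
import Summits.ValiantsHypothesis.ValiantsHypothesis.Theorems.BarrierLeverAnchoredDoorHitsLowerPairsStubGenericPoint

/-!
# Support item `AnchoredDoorHitsLowerPairs` (stmt-ValiantsHypothesis-22510), line `anchored-peeling`:
# the UQ_s PEELING STEP WITH A FACE TARGET (vertex source, target face of size ≤ s), its residual stub, and the kernel-checked induction

Helper file (`--supports stmt-ValiantsHypothesis-22510`; cell valiant-natproofs, rung V4, 𝒟-side door (c); registered line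
`Cruxes/AnchoredDoorHitsLowerPairs/Lines/anchored_peeling.lean` v12; prover seat val-np-p1 gen 19). Generalises `…UQStep.lean` (p613507, vertex target) to a TARGET
FACE `W₀` of the column complex with `1 ≤ |W₀| ≤ s`: one decidable predicate (`UQFData`), two `def … : Prop` stub texts OFFERED under D-0145 (`Stmt.stub_uqFaceStep`
— a THEOREM on paper, memo HOME/val-np-p1/g19/PEEL-HALL-valnp1-g19.md §16; `Stmt.stub_uqFaceResidual`), and the kernel-checked composition
`stub_symbolicNonvanishing_of_uqFace`. Closes NO item.

THE STEP (x-source form; the y-source form is the same statement for the swapped pair). For an injective simplicial-complex pair `(R, C)` at profile `s ≥ 1`, an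
`x`-vertex `a`, a column FACE `W₀ ∈ C` with `1 ≤ |W₀| ≤ s` and `m := ℓ_{W₀}(C) − ℓ_a(R) ≥ 0` (`ℓ_{W₀} = #{j : W₀ ⊆ w j}`), and an up-set `𝒜 ⊆ del_a R` of size `m` with
distinct roots `ρ A ⊆ A`, `1 ≤ |ρ A| ≤ s`: `symbolicDet_s(del_a R ∖ 𝒜, C ∖ st_C(W₀)) ≠ 0` and `symbolicDet_s(lk_a R, K₀) ≠ 0` (lower `K₀ ⊆ lk_C(W₀)`) imply
`symbolicDet_s(R, C) ≠ 0`. Mechanism: peel `a` onto the bare anchor `(a | W₀)` (a's only anchor; profile `|W₀| ≤ s`), keep at the target the face anchors `(ρA | W₀)`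
(profile ≤ s) with their tails, kernel reduction, private-monomial coefficient `= ± det 𝔄̂[del_a R ∖ 𝒜, C ∖ st W₀]`. WHY FACES MATTER: the gap `m` can be made
small by choosing a deep target face (`ℓ_{W₀}` just above `ℓ_a`), which is what covers the «deep versus very wide» pairs of memo §12 up to `q ≤ (s+1)·2^{s+1}`
(§17); e.g. cube₈ vs B(12,3) truncated to 256 faces: source = a column vertex, target = a cube edge, `m = 8`.

* `UQFData s u w a W₀ 𝒜 ρ` — the combinatorial data (decidable); `W₀ = {c}` is `UQData` of p613507.
* `Stmt.stub_uqFaceStep`, `Stmt.stub_uqFaceResidual` (at some fixed `s`: pairs with NO face-UQ data on either side are hit) — census: residual EMPTY on everything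
  we can enumerate (lab/uq.py, exp_facepeel*.py); first theoretical members at `s = 2`: cube₁₁/cube₁₂ vs truncated B(25,3) (r ≥ 2048).
* `stub_symbolicNonvanishing_of_uqFace` — **composition (kernel-checked)**: face step ∧ face residual ⟹ `Stmt.stub_symbolicNonvanishing`.

WHAT THIS IS NOT: `Stmt.stub_uqFaceStep` is not yet a kernel theorem (paper proof only); no claim on the residual; nothing on crux stmt-ValiantsHypothesis-14610 or
on `VP` versus `VNP`.
-/

set_option linter.dupNamespace false

namespace Summit.ValiantsHypothesis.ValiantsHypothesis.Theorems.BarrierLever.AnchoredPeeling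

open Finset

noncomputable section

variable {h : ℕ}

/-- **Face-UQ data** for peeling the `x`-vertex `a` onto the column face `W₀` (`1 ≤ |W₀| ≤ s`, `W₀` a face of `range w`) at profile `s`: `𝒜` is a
family of deletion faces, upward closed among them, with `ℓ_a + |𝒜| = ℓ_{W₀} := #{j : W₀ ⊆ w j}`; `ρ` gives distinct roots `ρ A ⊆ A`, `1 ≤ |ρ A| ≤ s`. -/
def UQFData (s : ℕ) {r : ℕ} (u w : Fin r → Finset (Fin h)) (a : Fin h) (W₀ : Finset (Fin h)) (𝒜 : Finset (Finset (Fin h)))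
    (ρ : Finset (Fin h) → Finset (Fin h)) : Prop :=
  (∃ i, a ∈ u i) ∧ W₀ ∈ Set.range w ∧ 1 ≤ W₀.card ∧ W₀.card ≤ s ∧
  (∀ A ∈ 𝒜, A ∈ Set.range u ∧ a ∉ A) ∧
  (∀ A ∈ 𝒜, ∀ i, A ⊆ u i → a ∉ u i → u i ∈ 𝒜) ∧
  (Finset.univ.filter (fun i => a ∈ u i)).card + 𝒜.card = (Finset.univ.filter (fun j => W₀ ⊆ w j)).card ∧
  (∀ A ∈ 𝒜, ρ A ⊆ A ∧ 1 ≤ (ρ A).card ∧ (ρ A).card ≤ s) ∧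
  Set.InjOn ρ (↑𝒜 : Set (Finset (Fin h)))

/-- **STUB (FACE-TARGET UQ_s-STEP; a theorem on paper).** Given face-UQ data at `(a, W₀)`, non-vanishing of the symbolic minors of the core pairs
`(del_a R ∖ 𝒜, C ∖ st_C(W₀))` and `(lk_a R, K₀)` (every injective lower `K₀` inside `lk_C(W₀)`) implies non-vanishing for `(R, C)`. -/
def Stmt.stub_uqFaceStep : Prop :=
  ∀ (s h r : ℕ) (u w : Fin r → Finset (Fin h)), 1 ≤ s → Function.Injective u → Function.Injective w →
    IsLowerSet (Set.range u) → IsLowerSet (Set.range w) →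
    ∀ (a : Fin h) (W₀ : Finset (Fin h)) (𝒜 : Finset (Finset (Fin h))) (ρ : Finset (Fin h) → Finset (Fin h)), UQFData s u w a W₀ 𝒜 ρ →
      (∀ (r₀ : ℕ) (u₀ w₀ : Fin r₀ → Finset (Fin h)), Function.Injective u₀ → Function.Injective w₀ →
          Set.range u₀ = {S | S ∈ Set.range u ∧ a ∉ S ∧ S ∉ 𝒜} → Set.range w₀ = {T | T ∈ Set.range w ∧ ¬ W₀ ⊆ T} →
          symbolicDet s h r₀ u₀ w₀ ≠ 0) →
      (∀ (r₁ : ℕ) (u₁ w₁ : Fin r₁ → Finset (Fin h)), Function.Injective u₁ → Function.Injective w₁ →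
          Set.range u₁ = {S | a ∉ S ∧ insert a S ∈ Set.range u} → Set.range w₁ ⊆ {T | Disjoint T W₀ ∧ T ∪ W₀ ∈ Set.range w} →
          IsLowerSet (Set.range w₁) → symbolicDet s h r₁ u₁ w₁ ≠ 0) →
      symbolicDet s h r u w ≠ 0

/-- **STUB (THE FACE-UQ RESIDUAL).** At some fixed profile `s ≥ 1` and all `h ≥ h₀`: every injective simplicial-complex pair with `r ≥ 2` rows that admits
NO face-UQ data on the `x`-side and none on the `y`-side still has nonzero symbolic minor. -/
def Stmt.stub_uqFaceResidual : Prop :=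
  ∃ s h₀ : ℕ, 1 ≤ s ∧ ∀ h : ℕ, h₀ ≤ h → ∀ (r : ℕ) (u w : Fin r → Finset (Fin h)),
    Function.Injective u → Function.Injective w → IsLowerSet (Set.range u) → IsLowerSet (Set.range w) → 2 ≤ r →
    (∀ (a : Fin h) (W₀ : Finset (Fin h)) (𝒜 : Finset (Finset (Fin h))) (ρ : Finset (Fin h) → Finset (Fin h)), ¬ UQFData s u w a W₀ 𝒜 ρ) →
    (∀ (c : Fin h) (Z : Finset (Fin h)) (𝒜 : Finset (Finset (Fin h))) (ρ : Finset (Fin h) → Finset (Fin h)), ¬ UQFData s w u c Z 𝒜 ρ) →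
    symbolicDet s h r u w ≠ 0

/-! ## Size and lower-set bookkeeping for the two sub-pairs -/

section Bookkeeping

variable {r : ℕ}

/-- The image of an injective `r`-family has `r` elements. -/
private theorem card_image_univ' {u : Fin r → Finset (Fin h)} (hu : Function.Injective u) :
    (Finset.univ.image u).card = r := by
  classical
  rw [Finset.card_image_of_injective _ hu, Finset.card_univ, Fintype.card_fin]

/-- An injective family whose range is a subset of `range u` missing the face `u i₀` is strictly shorter. -/
private theorem lt_of_range_subset_missing {r₀ : ℕ} {u : Fin r → Finset (Fin h)} {u₀ : Fin r₀ → Finset (Fin h)}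
    (hu : Function.Injective u) (hu₀ : Function.Injective u₀) (hsub : Set.range u₀ ⊆ Set.range u)
    (i₀ : Fin r) (hmiss : u i₀ ∉ Set.range u₀) : r₀ < r := by
  classical
  have hss : Finset.univ.image u₀ ⊂ Finset.univ.image u := by
    rw [Finset.ssubset_iff_subset_ne]
    refine ⟨?_, ?_⟩
    · intro x hx
      rw [Finset.mem_image] at hx ⊢
      obtain ⟨i, _, rfl⟩ := hx
      obtain ⟨j, hj⟩ := hsub ⟨i, rfl⟩
      exact ⟨j, Finset.mem_univ _, hj⟩
    · intro heq
      have : u i₀ ∈ Finset.univ.image u₀ := by rw [heq]; exact Finset.mem_image.mpr ⟨i₀, Finset.mem_univ _, rfl⟩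
      obtain ⟨i, _, hi⟩ := Finset.mem_image.mp this
      exact hmiss ⟨i, hi⟩
  have := Finset.card_lt_card hss
  rwa [card_image_univ' hu₀, card_image_univ' hu] at this

/-- The deletion-minus-up-set family is shorter than `u` (it misses a face containing `a`). -/
private theorem lt_of_deletion' {r₀ : ℕ} {u : Fin r → Finset (Fin h)} {u₀ : Fin r₀ → Finset (Fin h)} {a : Fin h}
    {𝒜 : Finset (Finset (Fin h))} (hu : Function.Injective u) (hu₀ : Function.Injective u₀) (ha : ∃ i, a ∈ u i)
    (hr₀ : Set.range u₀ = {S | S ∈ Set.range u ∧ a ∉ S ∧ S ∉ 𝒜}) : r₀ < r := by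
  obtain ⟨i₀, hi₀⟩ := ha
  refine lt_of_range_subset_missing hu hu₀ (fun S hS => by rw [hr₀] at hS; exact hS.1) i₀ ?_
  intro hmem
  rw [hr₀] at hmem
  exact hmem.2.1 hi₀

/-- The link family is shorter than `u` (its `insert a`-image misses `∅`). -/
private theorem lt_of_link' {r₁ : ℕ} {u : Fin r → Finset (Fin h)} {u₁ : Fin r₁ → Finset (Fin h)} {a : Fin h}
    (hu : Function.Injective u) (hu₁ : Function.Injective u₁) (hlu : IsLowerSet (Set.range u)) (ha : ∃ i, a ∈ u i)
    (hr₁ : Set.range u₁ = {S | a ∉ S ∧ insert a S ∈ Set.range u}) : r₁ < r := by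
  classical
  have hmem : ∀ i, a ∉ u₁ i ∧ insert a (u₁ i) ∈ Set.range u := fun i => by
    have hi : u₁ i ∈ Set.range u₁ := ⟨i, rfl⟩
    rw [hr₁] at hi
    exact hi
  let g : Fin r₁ → Finset (Fin h) := fun i => insert a (u₁ i)
  have hg : Function.Injective g := by
    intro i j hij
    apply hu₁
    have h1 : (insert a (u₁ i)).erase a = u₁ i := Finset.erase_insert (hmem i).1
    have h2 : (insert a (u₁ j)).erase a = u₁ j := Finset.erase_insert (hmem j).1
    rw [← h1, ← h2]
    exact congrArg (fun S => Finset.erase S a) hij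
  obtain ⟨i₀, hi₀⟩ := ha
  have hempty : (∅ : Finset (Fin h)) ∈ Set.range u := hlu (Finset.empty_subset (u i₀)) ⟨i₀, rfl⟩
  obtain ⟨j₀, hj₀⟩ := hempty
  refine lt_of_range_subset_missing hu hg ?_ j₀ ?_
  · rintro S ⟨i, rfl⟩
    exact (hmem i).2
  · rintro ⟨i, hi⟩
    have : a ∈ (∅ : Finset (Fin h)) := by rw [← hj₀, ← hi]; exact Finset.mem_insert_self _ _
    exact Finset.notMem_empty _ this

/-- The deletion complex minus an up-set is a lower family. -/
private theorem lowerSet_deletion' {r₀ : ℕ} {u : Fin r → Finset (Fin h)} {u₀ : Fin r₀ → Finset (Fin h)} {a : Fin h}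
    {𝒜 : Finset (Finset (Fin h))} (hlu : IsLowerSet (Set.range u)) (hup : ∀ A ∈ 𝒜, ∀ i, A ⊆ u i → a ∉ u i → u i ∈ 𝒜)
    (hr₀ : Set.range u₀ = {S | S ∈ Set.range u ∧ a ∉ S ∧ S ∉ 𝒜}) : IsLowerSet (Set.range u₀) := by
  rw [hr₀]
  intro S T hTS hS
  obtain ⟨⟨i, hi⟩, haS, hS𝒜⟩ := hS
  refine ⟨hlu hTS ⟨i, hi⟩, fun haT => haS (hTS haT), fun hT𝒜 => hS𝒜 ?_⟩
  have := hup T hT𝒜 i (hi ▸ hTS) (hi ▸ haS)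
  rwa [hi] at this

/-- Removing the (up-closed) star of a face from a lower family leaves a lower family. -/
private theorem lowerSet_colStarDeletion' {r₀ : ℕ} {w : Fin r → Finset (Fin h)} {w₀ : Fin r₀ → Finset (Fin h)} {W₀ : Finset (Fin h)}
    (hlw : IsLowerSet (Set.range w)) (hr₀ : Set.range w₀ = {T | T ∈ Set.range w ∧ ¬ W₀ ⊆ T}) : IsLowerSet (Set.range w₀) := by
  rw [hr₀]
  intro S T hTS hS
  exact ⟨hlw hTS hS.1, fun hT => hS.2 (hT.trans hTS)⟩

/-- The link of a vertex is a lower family. -/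
private theorem lowerSet_link' {r₁ : ℕ} {u : Fin r → Finset (Fin h)} {u₁ : Fin r₁ → Finset (Fin h)} {a : Fin h}
    (hlu : IsLowerSet (Set.range u)) (hr₁ : Set.range u₁ = {S | a ∉ S ∧ insert a S ∈ Set.range u}) :
    IsLowerSet (Set.range u₁) := by
  rw [hr₁]
  intro S T hTS hS
  exact ⟨fun haT => hS.1 (hTS haT), hlu (Finset.insert_subset_insert a hTS) hS.2⟩

end Bookkeeping

/-- **THE INDUCTION (kernel-checked): face-target UQ_s-step ∧ face-UQ-residual ⟹ the line's symbolic non-vanishing stub.** At the residual's profile `s`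
and `h ≥ h₀`, by strong induction on `r`: `r ≤ 1` by `stub_base`; otherwise either face-UQ data exist on the `x`-side (apply the step; both sub-pairs are injective
lower pairs with fewer rows), or on the `y`-side (the same for the swapped pair, `symbolicDet_ne_zero_comm`), or on neither side (the residual stub). -/
theorem stub_symbolicNonvanishing_of_uqFace (hstep : Stmt.stub_uqFaceStep) (hres : Stmt.stub_uqFaceResidual) :
    Stmt.stub_symbolicNonvanishing := by
  obtain ⟨s, h₀, hs, hR⟩ := hres
  refine ⟨s, h₀, fun h hh => ?_⟩
  intro r
  induction r using Nat.strong_induction_on with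
  | _ r ih =>
    intro u w hu hw hlu hlw
    by_cases hr : r ≤ 1
    · exact stub_base s h r u w hu hw hlu hlw hr
    · have hr2 : 2 ≤ r := by omega
      by_cases hx : ∃ (a : Fin h) (W₀ : Finset (Fin h)) (𝒜 : Finset (Finset (Fin h))) (ρ : Finset (Fin h) → Finset (Fin h)),
          UQFData s u w a W₀ 𝒜 ρ
      · obtain ⟨a, W₀, 𝒜, ρ, hD⟩ := hx
        have ha : ∃ i, a ∈ u i := hD.1
        have hup := hD.2.2.2.2.2.1
        refine hstep s h r u w hs hu hw hlu hlw a W₀ 𝒜 ρ hD ?_ ?_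
        · intro r₀ u₀ w₀ hu₀ hw₀ hru₀ hrw₀
          exact ih r₀ (lt_of_deletion' hu hu₀ ha hru₀) u₀ w₀ hu₀ hw₀ (lowerSet_deletion' hlu hup hru₀)
            (lowerSet_colStarDeletion' hlw hrw₀)
        · intro r₁ u₁ w₁ hu₁ hw₁ hru₁ _ hlw₁
          exact ih r₁ (lt_of_link' hu hu₁ hlu ha hru₁) u₁ w₁ hu₁ hw₁ (lowerSet_link' hlu hru₁) hlw₁
      · by_cases hy : ∃ (c : Fin h) (Z : Finset (Fin h)) (𝒜 : Finset (Finset (Fin h))) (ρ : Finset (Fin h) → Finset (Fin h)),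
            UQFData s w u c Z 𝒜 ρ
        · obtain ⟨c, Z, 𝒜, ρ, hD⟩ := hy
          have hc : ∃ j, c ∈ w j := hD.1
          have hup := hD.2.2.2.2.2.1
          refine (symbolicDet_ne_zero_comm s h r u w).mpr (hstep s h r w u hs hw hu hlw hlu c Z 𝒜 ρ hD ?_ ?_)
          · intro r₀ u₀ w₀ hu₀ hw₀ hru₀ hrw₀
            exact ih r₀ (lt_of_deletion' hw hu₀ hc hru₀) u₀ w₀ hu₀ hw₀ (lowerSet_deletion' hlw hup hru₀)
              (lowerSet_colStarDeletion' hlu hrw₀)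
          · intro r₁ u₁ w₁ hu₁ hw₁ hru₁ _ hlw₁
            exact ih r₁ (lt_of_link' hw hu₁ hlw hc hru₁) u₁ w₁ hu₁ hw₁ (lowerSet_link' hlw hru₁) hlw₁
        · push Not at hx hy
          exact hR h hh r u w hu hw hlu hlw hr2 (fun a W₀ 𝒜 ρ => hx a W₀ 𝒜 ρ) (fun c Z 𝒜 ρ => hy c Z 𝒜 ρ)

/-- Hence an anchored hit at the residual's profile (the landed `stub_genericPoint`). -/
theorem anchoredHit_of_uqFace (hstep : Stmt.stub_uqFaceStep) (hres : Stmt.stub_uqFaceResidual) :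
    ∃ s h₀ : ℕ, ∀ h : ℕ, h₀ ≤ h → ∀ (r : ℕ) (u w : Fin r → Finset (Fin h)),
      Function.Injective u → Function.Injective w → IsLowerSet (Set.range u) → IsLowerSet (Set.range w) → AnchoredHit s h r u w := by
  obtain ⟨s, h₀, H⟩ := stub_symbolicNonvanishing_of_uqFace hstep hres
  exact ⟨s, h₀, fun h hh r u w hu hw hlu hlw => stub_genericPoint s h r u w (H h hh r u w hu hw hlu hlw)⟩

end

end Summit.ValiantsHypothesis.ValiantsHypothesis.Theorems.BarrierLever.AnchoredPeeling
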